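import Literature.Topology.FourManifolds.LefschetzBaseOpenBook
import HarnessLib

/-!
# The angular differential of the Kas fibration `π = w/‖w‖` of `∂ Base g`

Topic `Literature/Topology/FourManifolds`; a proofs-only supplement (no definition, no named
fact) of `LefschetzBaseOpenBook.lean` (§14–15: the fibration `LefschetzBase.proj g = w/‖w‖` of
the boundary open book of the Lefschetz base, smooth with non-vanishing angular differential off
the binding — there established along special curves).  Here the angular differential is
computed on an ARBITRARY tangent vector:

* `angularDeriv_proj_apply` — **`dθ_y(u) = ‖w‖⁻² · Im( w̄ · D(w ∘ inclB)_y(u) )`** for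
  `w = w g (inclB g y) ≠ 0`: the angle form at `w/‖w‖` applied to the derivative of
  `ζ ↦ ζ/‖ζ‖` (whose radial part it kills) composed with the derivative of `w` along the
  boundary.  So `dθ(u) > 0` iff `Im(w̄ · Dw(u)) > 0`, i.e. `Im(Dw(u)/w) > 0`.

Use: the transversality clause of the Reeb criterion for the base case of
`Literature.Geometry.Symplectic.palf_stein_supportedByBoundaryOpenBook`
(`LefschetzBaseModelReebPositive.lean`: `Re(w̄ · Dw(G)) > 0` for the Levi gradient `G`, and
`Dw(J₀ G) = i Dw(G)`).

## References

* J. B. Etnyre, *Lectures on open book decompositions and contact structures*, Clay Math.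
  Proc. 5 (2006), §2 and Lemma 3.3. [Etnyre2006]
-/

noncomputable section

open scoped Manifold ContDiff Topology ComplexConjugate
open Set Function Metric Complex Filter

namespace Literature.Topology.FourManifolds

namespace LefschetzBase

open Literature.Geometry.Symplectic

/-- The normalisation map `ζ ↦ ζ/‖ζ‖` read in `ℝ²` has, at `ζ₀ ≠ 0`, a derivative of the form
`ζ' ↦ a(ζ') • vec2 ζ₀ + ‖ζ₀‖⁻¹ • vec2 ζ'` (radial part + scaled identity). [folklore] -/
theorem hasFDerivAt_normalize_vec2 {ζ₀ : ℂ} (h0 : ζ₀ ≠ 0) :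
    ∃ L : ℂ →L[ℝ] ℝ, HasFDerivAt (fun ζ : ℂ => ‖ζ‖⁻¹ • vec2 ζ)
      (‖ζ₀‖⁻¹ • vec2L + L.smulRight (vec2 ζ₀)) ζ₀ := by
  have hn : DifferentiableAt ℝ (fun ζ : ℂ => ‖ζ‖) ζ₀ := differentiableAt_id.norm ℝ h0
  have hi : DifferentiableAt ℝ (fun ζ : ℂ => ‖ζ‖⁻¹) ζ₀ := hn.inv (norm_ne_zero_iff.2 h0)
  refine ⟨fderiv ℝ (fun ζ : ℂ => ‖ζ‖⁻¹) ζ₀, ?_⟩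
  exact hi.hasFDerivAt.smul (vec2L.hasFDerivAt (x := ζ₀))

/-- **The angular differential of `π = w/‖w‖` on an arbitrary tangent vector**: off the binding,
`dθ_y(u) = ‖w‖⁻² Im( w̄ · D(w ∘ inclB)_y(u) )`, `w = w g (inclB g y)`. [cite: Etnyre2006, §2] -/
theorem angularDeriv_proj_apply (g : ℕ) {y : (bBase g).carrier} (hy : w g (inclB g y) ≠ 0)
    (u : EuclideanSpace ℝ (Fin 3)) :
    angularDeriv (proj g) y u =
      (‖w g (inclB g y)‖ ^ 2)⁻¹ *
        (conj (w g (inclB g y)) *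
          (show EuclideanSpace ℝ (Fin 3) →L[ℝ] ℂ from
            mfderiv (𝓡 3) 𝓘(ℝ, ℂ) (fun z => w g (inclB g z)) y) u).im := by
  set w₀ : ℂ := w g (inclB g y) with hw₀
  set wB : (bBase g).carrier → ℂ := fun z => w g (inclB g z) with hwB
  set F : ℂ → EuclideanSpace ℝ (Fin 2) := fun ζ => ‖ζ‖⁻¹ • vec2 ζ with hF
  -- `π` read in `ℝ²` is `F ∘ wB` near `y`
  have hloc : (fun z => ((proj g z : Metric.sphere (0 : EuclideanSpace ℝ (Fin 2)) 1) :
      EuclideanSpace ℝ (Fin 2))) =ᶠ[𝓝 y] (F ∘ wB) := by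
    filter_upwards [(isOpen_w_ne_zero g).mem_nhds hy] with z hz
    exact coe_proj g hz
  -- derivatives
  obtain ⟨L, hFd⟩ := hasFDerivAt_normalize_vec2 hy
  have hwBd : MDifferentiableAt (𝓡 3) 𝓘(ℝ, ℂ) wB y :=
    (contMDiff_w_inclB g y).mdifferentiableAt (by simp)
  have hFmd : MDifferentiableAt 𝓘(ℝ, ℂ) 𝓘(ℝ, EuclideanSpace ℝ (Fin 2)) F (wB y) :=
    hFd.differentiableAt.mdifferentiableAt
  have hcomp := mfderiv_comp y hFmd hwBd
  set ζ' : ℂ := (show EuclideanSpace ℝ (Fin 3) →L[ℝ] ℂ from mfderiv (𝓡 3) 𝓘(ℝ, ℂ) wB y) u with hζ'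
  have hval : mfderiv (𝓡 3) 𝓘(ℝ, EuclideanSpace ℝ (Fin 2)) (F ∘ wB) y u =
      (‖w₀‖⁻¹ • vec2L + L.smulRight (vec2 w₀)) ζ' := by
    rw [hcomp]
    show (mfderiv 𝓘(ℝ, ℂ) 𝓘(ℝ, EuclideanSpace ℝ (Fin 2)) F (wB y))
      ((mfderiv (𝓡 3) 𝓘(ℝ, ℂ) wB y) u) = _
    rw [mfderiv_eq_fderiv, hFd.fderiv]
    rfl
  rw [angularDeriv_apply, hloc.mfderiv_eq]
  refine (congrArg (angleForm _) hval).trans ?_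
  rw [coe_proj g hy]
  -- evaluate the angle form
  simp only [add_apply, FunLike.coe_smul, Pi.smul_apply,
    vec2L_apply, ContinuousLinearMap.smulRight_apply, angleForm_apply, PiLp.add_apply,
    PiLp.smul_apply, vec2_apply_zero, vec2_apply_one, smul_eq_mul, Complex.mul_im,
    Complex.conj_re, Complex.conj_im]
  simp only [← hw₀]
  have hn : ‖w₀‖ ≠ 0 := norm_ne_zero_iff.2 hy
  field_simp
  ring

/-- **Sign form**: off the binding, `dθ_y(u) > 0 ↔ Im( w̄ · D(w ∘ inclB)_y(u) ) > 0`.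
[cite: Etnyre2006, §2] -/
theorem angularDeriv_proj_pos_iff (g : ℕ) {y : (bBase g).carrier} (hy : w g (inclB g y) ≠ 0)
    (u : EuclideanSpace ℝ (Fin 3)) :
    0 < angularDeriv (proj g) y u ↔
      0 < (conj (w g (inclB g y)) *
        (show EuclideanSpace ℝ (Fin 3) →L[ℝ] ℂ from
            mfderiv (𝓡 3) 𝓘(ℝ, ℂ) (fun z => w g (inclB g z)) y) u).im := by
  rw [angularDeriv_proj_apply g hy u]
  have hpos : 0 < (‖w g (inclB g y)‖ ^ 2)⁻¹ := by
    have := norm_pos_iff.2 hy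
    positivity
  exact mul_pos_iff_of_pos_left hpos

end LefschetzBase

end Literature.Topology.FourManifolds

end
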